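import Literature.AlgebraicGeometry.Motives.ThickeningModelNaturality
import Literature.AlgebraicGeometry.Motives.ThickeningPtSections
import Literature.AlgebraicGeometry.Motives.CartierDivisorCechTrivialization
import Literature.RingTheory.Flat.SmallExtensionBaseChange
import Mathlib.AlgebraicGeometry.Noetherian
import Mathlib.RingTheory.LocalRing.ResidueField.Basic
import Mathlib.LinearAlgebra.Dimension.Free
import HarnessLib

/-!
# The tower `κ(x) ← 𝒪_{T,x}/𝔪 ← 𝒪_{T,x}/𝔪² ← ⋯` over an affine neighbourhood: small extensions

For a point `x` of an affine open `B` of a scheme `T` (ring `Λ = Γ(B, 𝒪_T)`, local ring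
`𝒪 = 𝒪_{T,x}` with maximal ideal `𝔪`, an algebra over `Λ` by the germ map) this file sets up the
`Λ`-algebras `A_n = 𝒪/𝔪^{n+1}` (`thickRing`) and `κ = 𝒪/𝔪` (`resField`), the surjections
`π_n : A_{n+1} → A_n` (`thickπ`), `ρ_n : A_n → κ` (`thickρ`), and proves that for `T` locally
noetherian each `A_{n+1} → A_n` is a **small extension with framed kernel** in the sense of
`Literature.RingTheory.Flat.IsSmallExtension` (`Literature/RingTheory/Flat/SmallExtensionBaseChange`):
the kernel `I_n = 𝔪^{n+1}/𝔪^{n+2}` is killed by `𝔪`, hence a finite-dimensional `κ`-vector space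
(`𝒪` is noetherian, Mathlib's instance for stalks of locally noetherian schemes), and a choice of
basis gives `e_n : κ^{d_n} ≅ I_n` compatible with the `A_{n+1}`-action (`thickSmallExtension`).
This is the induction skeleton of Step (I) of the proof of Görtz–Wedhorn II, Lemma 24.72 in the
variant "`A = 𝒪/𝔪^{n+2} → A₀ = 𝒪/𝔪^{n+1}`, kernel `≅ κ^d`" (the printed proof inducts on the length
through extensions with kernel `≅ κ`; both only use that the kernel is a `κ`-vector space).

Also recorded: the bases `Spec A_n → T`, `Spec κ → T` of `Motives/ThickeningModel` for these
rings are the infinitesimal neighbourhoods `thickeningPtι T x n` of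
`Motives/TheoremOfCubeThickenings` and Mathlib's `fromSpecResidueField` (`baseSpec_thickRing`,
`baseSpec_resField`), in particular they have image `{x}` (`baseSpec_thickRing_apply`,
`baseSpec_resField_apply`, `snd_whiskerLeft_modelPtι_apply`); for a `K`-scheme `P` and an affine
open `V ⊆ pr_T⁻¹B` of `P ×_K T` the ring `Γ(V)` is flat over `Λ` (`OpenOver.flat_sec`, Mathlib
`HasRingHomProperty` for `@Flat`), its preimages in the thickenings and pairwise intersections are
affine (`OpenOver.isAffineOpen_thick`, `isAffineOpen_inf`); and the fibre of `P ×_K T → T` over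
`x` admits a finite cover by affine opens `V_a ⊆ pr_T⁻¹B`, each inside a chart of a given Cartier
divisor (`FibreCover`, `FibreCover.nonempty`, for `P → Spec K` quasi-compact), whose preimages
cover every `P ×_K Spec R` with `Spec R → T` concentrated at `x` (`FibreCover.iSup_thick`).

In this tree (bridged, not duplicated): `stalkModPow`, `stalkModPowMk`, `stalkModPowTransitionHom(_mk/_surjective)`
of `Motives/ThickeningPtSections` (= `Morphisms.infinitesimalNeighbourhood.transitionRingHom` of
`Morphisms/FormalFunctions`) are the same tower without the `Γ(B)`-algebra structure
(`thickRing_eq_stalkModPow`, `thickπ_toRingHom`, by `rfl`); `thickeningPt(ι)` of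
`Motives/TheoremOfCubeThickenings` and `residuePt` of `Motives/SeesawTheorem` are the model bases
(`modelPt_thickRing`, `modelPt_resField`).
Mathlib searched (pin): `TopCat.Presheaf.algebra_section_stalk`, `IsLocallyNoetherian` stalk
instance, `Ideal.Quotient.factorₐ`, `Ideal.mem_quotient_iff_mem`, `Module.IsTorsionBySet.module`,
`Module.finBasis`, `Module.Finite.of_restrictScalars_finite`, `HasRingHomProperty.appLE`,
`isAffineHom_diagonal_iff`, `Scheme.Hom.isPullback_resLE`, `Scheme.Pullback.exists_preimage_pullback`,
`exists_isAffineOpen_mem_and_subset`, `IsCompact.elim_finite_subcover` (used).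

## References

* U. Görtz, T. Wedhorn, *Algebraic Geometry II: Cohomology of Schemes*, Springer Spektrum (2023),
  doi:10.1007/978-3-658-43031-3: Lemma 24.72, proof, Step (I), p. 548. [GortzWedhorn2023]
-/

universe u

open CategoryTheory CategoryTheory.Limits AlgebraicGeometry MonoidalCategory TopologicalSpace
open CartesianMonoidalCategory TensorProduct IsLocalRing

noncomputable section

namespace Literature.AlgebraicGeometry.Motives

variable {K : Type u} [Field K] (T : SchemeOver K) {B : T.left.Opens} (x : B)

/-! ### The rings `𝒪_{T,x}`, `A_n = 𝒪/𝔪^{n+1}`, `κ = 𝒪/𝔪` over `Λ = Γ(B, 𝒪_T)` -/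

/-- The local ring `𝒪_{T,x}` of a point of the affine open `B`, a `Γ(B, 𝒪_T)`-algebra by the
germ map (Mathlib `TopCat.Presheaf.algebra_section_stalk`). [folklore] -/
abbrev stalkAt : Type u := T.left.presheaf.stalk x.1

/-- `A_n = 𝒪_{T,x}/𝔪^{n+1}` — the ring of the `n`-th infinitesimal neighbourhood
`Spec(𝒪_{T,x}/𝔪^{n+1})` of `x` (Görtz–Wedhorn II, Thm. 24.42, Lemma 24.72: the local Artinian
quotients `A` of `𝒪_{S,s}`). [cite: GortzWedhorn2023, Lemma 24.72, proof (p. 548)] -/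
abbrev thickRing (n : ℕ) : Type u := stalkAt T x ⧸ maximalIdeal (stalkAt T x) ^ (n + 1)

/-- `κ = κ(x) = 𝒪_{T,x}/𝔪`, the residue field. [folklore] -/
abbrev resField : Type u := ResidueField (stalkAt T x)

/-- `𝔪^{n+2} ≤ 𝔪^{n+1}`. [folklore] -/
theorem pow_succ_le (n : ℕ) :
    maximalIdeal (stalkAt T x) ^ (n + 1 + 1) ≤ maximalIdeal (stalkAt T x) ^ (n + 1) :=
  Ideal.pow_le_pow_right (Nat.le_succ _)

/-- `𝔪^{n+1} ≤ 𝔪`. [folklore] -/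
theorem pow_le (n : ℕ) : maximalIdeal (stalkAt T x) ^ (n + 1) ≤ maximalIdeal (stalkAt T x) :=
  Ideal.pow_le_self (Nat.succ_ne_zero n)

/-- **`π_n : A_{n+1} → A_n`**, the transition map `𝒪/𝔪^{n+2} → 𝒪/𝔪^{n+1}`, as a `Γ(B)`-algebra
homomorphism. [folklore] -/
def thickπ (n : ℕ) : thickRing T x (n + 1) →ₐ[Γ(T.left, B)] thickRing T x n :=
  Ideal.Quotient.factorₐ _ (pow_succ_le T x n)

/-- **`ρ_n : A_n → κ`**, the residue map `𝒪/𝔪^{n+1} → 𝒪/𝔪`, as a `Γ(B)`-algebra homomorphism.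
[folklore] -/
def thickρ (n : ℕ) : thickRing T x n →ₐ[Γ(T.left, B)] resField T x :=
  Ideal.Quotient.factorₐ _ (pow_le T x n)

/-- **Bridge to the tree's tower** (`Motives/ThickeningPtSections`): the carrier of
`stalkModPow T x n` is `A_n` (definitional). [folklore] -/
theorem thickRing_eq_stalkModPow (n : ℕ) : thickRing T x n = ↥(stalkModPow T x.1 n) := rfl

/-- **Bridge**: as a ring homomorphism `π_n` is the tree's `stalkModPowTransitionHom T x n`
(`= Morphisms.infinitesimalNeighbourhood.transitionRingHom (maximalIdeal _) n`; definitional).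
[folklore] -/
theorem thickπ_toRingHom (n : ℕ) :
    (thickπ T x n : thickRing T x (n + 1) →+* thickRing T x n) = stalkModPowTransitionHom T x.1 n :=
  rfl

/-- **Bridge**: as a ring homomorphism `ρ_n` is `Ideal.Quotient.factor` (definitional). [folklore] -/
theorem thickρ_toRingHom (n : ℕ) :
    (thickρ T x n : thickRing T x n →+* resField T x) = Ideal.Quotient.factor (pow_le T x n) := rfl

/-- `π_n` on residue classes (the tree's `stalkModPowTransitionHom_mk`). [folklore] -/
@[simp] theorem thickπ_mk (n : ℕ) (r : stalkAt T x) :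
    thickπ T x n (Ideal.Quotient.mk _ r) = Ideal.Quotient.mk _ r :=
  stalkModPowTransitionHom_mk T x.1 n r

/-- `ρ_n` on residue classes. [folklore] -/
@[simp] theorem thickρ_mk (n : ℕ) (r : stalkAt T x) :
    thickρ T x n (Ideal.Quotient.mk _ r) = Ideal.Quotient.mk _ r := rfl

/-- `ρ_n ∘ π_n = ρ_{n+1}`. [folklore] -/
theorem thickρ_comp_thickπ (n : ℕ) : (thickρ T x n).comp (thickπ T x n) = thickρ T x (n + 1) := by
  apply AlgHom.ext
  intro r
  obtain ⟨r, rfl⟩ := Ideal.Quotient.mk_surjective r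
  rfl

/-- `π_n` is surjective (the tree's `stalkModPowTransitionHom_surjective`). [folklore] -/
theorem thickπ_surjective (n : ℕ) : Function.Surjective (thickπ T x n) :=
  stalkModPowTransitionHom_surjective T x.1 n

/-- `ρ_n` is surjective. [folklore] -/
theorem thickρ_surjective (n : ℕ) : Function.Surjective (thickρ T x n) :=
  Ideal.Quotient.factor_surjective (pow_le T x n)

/-- `ρ_n r = 0 ↔ r ∈ 𝔪 / 𝔪^{n+1}`. [folklore] -/
theorem thickρ_eq_zero_iff (n : ℕ) (r : stalkAt T x) :
    thickρ T x n (Ideal.Quotient.mk _ r) = 0 ↔ r ∈ maximalIdeal (stalkAt T x) := by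
  rw [thickρ_mk]
  exact Ideal.Quotient.eq_zero_iff_mem

/-- `π_n r = 0 ↔ r ∈ 𝔪^{n+1}`. [folklore] -/
theorem thickπ_eq_zero_iff (n : ℕ) (r : stalkAt T x) :
    thickπ T x n (Ideal.Quotient.mk _ r) = 0 ↔ r ∈ maximalIdeal (stalkAt T x) ^ (n + 1) := by
  rw [thickπ_mk]
  exact Ideal.Quotient.eq_zero_iff_mem

/-! ### The kernel `I_n = 𝔪^{n+1}/𝔪^{n+2}` as a `κ`-vector space -/

/-- **`I_n = 𝔪^{n+1}/𝔪^{n+2} ⊆ A_{n+1}`**, the kernel of `π_n`. [folklore] -/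
def thickKer (n : ℕ) : Ideal (thickRing T x (n + 1)) :=
  (maximalIdeal (stalkAt T x) ^ (n + 1)).map (Ideal.Quotient.mk _)

/-- Membership in `I_n`: `r̄ ∈ I_n ↔ r ∈ 𝔪^{n+1}`. [folklore] -/
theorem mk_mem_thickKer_iff (n : ℕ) (r : stalkAt T x) :
    Ideal.Quotient.mk _ r ∈ thickKer T x n ↔ r ∈ maximalIdeal (stalkAt T x) ^ (n + 1) :=
  Ideal.mem_quotient_iff_mem (pow_succ_le T x n)

/-- `π_n y = 0 ↔ y ∈ I_n`. [folklore] -/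
theorem thickπ_eq_zero_iff_mem (n : ℕ) (y : thickRing T x (n + 1)) :
    thickπ T x n y = 0 ↔ y ∈ thickKer T x n := by
  obtain ⟨r, rfl⟩ := Ideal.Quotient.mk_surjective y
  rw [thickπ_eq_zero_iff, mk_mem_thickKer_iff]

/-- **`𝔪 · I_n = 0`**: the kernel is killed by the maximal ideal (`𝔪 · 𝔪^{n+1} ⊆ 𝔪^{n+2}`), so it
is a `κ`-vector space. [folklore] -/
theorem smul_thickKer_eq_zero (n : ℕ) {r : stalkAt T x} (hr : r ∈ maximalIdeal (stalkAt T x))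
    (y : thickKer T x n) : r • (y : thickRing T x (n + 1)) = 0 := by
  obtain ⟨y, hy⟩ := y
  obtain ⟨s, rfl⟩ := Ideal.Quotient.mk_surjective y
  rw [mk_mem_thickKer_iff] at hy
  change Ideal.Quotient.mk _ r * Ideal.Quotient.mk _ s = 0
  rw [← map_mul, Ideal.Quotient.eq_zero_iff_mem, pow_succ']
  exact Ideal.mul_mem_mul hr hy

/-- `I_n` is torsion by `𝔪` as an `𝒪`-module. [folklore] -/
theorem isTorsionBySet_thickKer (n : ℕ) :
    Module.IsTorsionBySet (stalkAt T x) (thickKer T x n) (maximalIdeal (stalkAt T x)) := by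
  rintro y ⟨r, hr⟩
  exact Subtype.ext (smul_thickKer_eq_zero T x n hr y)

/-- The `κ`-vector space structure on `I_n` (`κ = 𝒪/𝔪` acting through representatives; Mathlib
`Module.IsTorsionBySet.module`). [folklore] -/
instance moduleResFieldThickKer (n : ℕ) : Module (resField T x) (thickKer T x n) :=
  (isTorsionBySet_thickKer T x n).module

/-- The `κ`-action on `I_n` is through representatives: `r̄ • y = r • y`. [folklore] -/
theorem residue_smul_thickKer (n : ℕ) (r : stalkAt T x) (y : thickKer T x n) :
    (residue (stalkAt T x) r) • y = r • y :=
  (isTorsionBySet_thickKer T x n).mk_smul r y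

/-- `𝒪 → κ → I_n` is a scalar tower. [folklore] -/
instance isScalarTower_stalk_resField_thickKer (n : ℕ) :
    IsScalarTower (stalkAt T x) (resField T x) (thickKer T x n) :=
  (isTorsionBySet_thickKer T x n).isScalarTower

/-- `Γ(B) → κ → I_n` is a scalar tower. [folklore] -/
instance isScalarTower_sections_resField_thickKer (n : ℕ) :
    IsScalarTower Γ(T.left, B) (resField T x) (thickKer T x n) :=
  ⟨fun a μ y => (congrArg (· • y) (algebraMap_smul (stalkAt T x) a μ).symm).trans
    ((smul_assoc _ _ _).trans (algebraMap_smul (stalkAt T x) a (μ • y)))⟩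

variable [IsLocallyNoetherian T.left]

/-- `I_n` is a finitely generated `𝒪`-module (`𝒪_{T,x}` is noetherian for `T` locally noetherian).
[folklore] -/
instance finite_stalk_thickKer (n : ℕ) : Module.Finite (stalkAt T x) (thickKer T x n) := by
  haveI : IsNoetherianRing (thickRing T x (n + 1)) := inferInstance
  haveI : Module.Finite (thickRing T x (n + 1)) (thickKer T x n) := inferInstance
  exact Module.Finite.trans (thickRing T x (n + 1)) (thickKer T x n)

/-- **`I_n` is a finite-dimensional `κ`-vector space.** [folklore] -/
instance finite_resField_thickKer (n : ℕ) : Module.Finite (resField T x) (thickKer T x n) :=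
  Module.Finite.of_restrictScalars_finite (stalkAt T x) _ _

/-- `d_n = dim_κ I_n`. [folklore] -/
def thickDim (n : ℕ) : ℕ := Module.finrank (resField T x) (thickKer T x n)

/-- **The framing `e_n : κ^{d_n} ≅ I_n`** (a chosen basis, Mathlib `Module.finBasis`), as a
`Γ(B)`-linear isomorphism. [folklore] -/
def thickFrame (n : ℕ) : (Fin (thickDim T x n) → resField T x) ≃ₗ[Γ(T.left, B)] thickKer T x n :=
  ((Module.finBasis (resField T x) (thickKer T x n)).equivFun.symm).restrictScalars Γ(T.left, B)

/-- `e_n` is the chosen basis isomorphism. [folklore] -/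
theorem thickFrame_apply (n : ℕ) (v : Fin (thickDim T x n) → resField T x) :
    thickFrame T x n v = (Module.finBasis (resField T x) (thickKer T x n)).equivFun.symm v := rfl

/-- `e_n` is `κ`-linear, hence compatible with the `A_{n+1}`-action through `ρ_{n+1}`:
`e_n(ρ(r) v) = r · e_n(v)`. [folklore] -/
theorem thickFrame_smul (n : ℕ) (r : thickRing T x (n + 1)) (v : Fin (thickDim T x n) → resField T x) :
    (thickFrame T x n (fun ℓ => thickρ T x (n + 1) r * v ℓ) : thickRing T x (n + 1)) =
      r * thickFrame T x n v := by
  obtain ⟨r, rfl⟩ := Ideal.Quotient.mk_surjective r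
  set b := Module.finBasis (resField T x) (thickKer T x n) with hb
  have e1 : (fun ℓ => thickρ T x (n + 1) (Ideal.Quotient.mk _ r) * v ℓ) =
      (residue (stalkAt T x) r) • v := by
    ext ℓ; rfl
  have h2 : b.equivFun.symm ((residue (stalkAt T x) r) • v) =
      (residue (stalkAt T x) r) • b.equivFun.symm v :=
    b.equivFun.symm.map_smul _ _
  have h3 : (((residue (stalkAt T x) r) • b.equivFun.symm v : thickKer T x n) :
      thickRing T x (n + 1)) =
      Ideal.Quotient.mk _ r * (b.equivFun.symm v : thickRing T x (n + 1)) := by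
    have := congrArg (fun z : thickKer T x n => (z : thickRing T x (n + 1)))
      (residue_smul_thickKer T x n r (b.equivFun.symm v))
    exact this.trans (Submodule.coe_smul_of_tower _ _)
  rw [e1, thickFrame_apply, thickFrame_apply, ← hb, h2]
  exact h3

/-- **`A_{n+1} → A_n` is a small extension with framed kernel `I_n ≅ κ^{d_n}`** over `Λ = Γ(B)`
(`Literature.RingTheory.Flat.IsSmallExtension` with `π = π_n`, `ρ = ρ_{n+1}`, `I = I_n`,
`e = e_n`): `π_n`, `ρ_{n+1}` surjective, `ker π_n = I_n`, `ker ρ_{n+1} = 𝔪/𝔪^{n+2}` nilpotent,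
`e_n` compatible with the `A_{n+1}`-action. This is the input of the flat base change
`Γ(V) ⊗_Λ (0 → I_n → A_{n+1} → A_n → 0)` in Step (I) of the proof of Görtz–Wedhorn II, Lemma 24.72.
[cite: GortzWedhorn2023, Lemma 24.72, proof, Step (I) (p. 548)] -/
theorem thickSmallExtension (n : ℕ) :
    Literature.RingTheory.Flat.IsSmallExtension (thickπ T x n) (thickρ T x (n + 1)) (thickKer T x n)
      (thickFrame T x n) where
  surjective_π := thickπ_surjective T x n
  surjective_ρ := thickρ_surjective T x (n + 1)
  mem_ker_π := thickπ_eq_zero_iff_mem T x n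
  isNilpotent_ker_ρ := by
    refine ⟨n + 1 + 1, ?_⟩
    have hle : RingHom.ker (thickρ T x (n + 1)) ≤
        (maximalIdeal (stalkAt T x)).map (Ideal.Quotient.mk _) := by
      intro y hy
      obtain ⟨r, rfl⟩ := Ideal.Quotient.mk_surjective y
      exact Ideal.mem_map_of_mem _ ((thickρ_eq_zero_iff T x (n + 1) r).1 hy)
    rw [Submodule.zero_eq_bot, eq_bot_iff]
    refine (Ideal.pow_right_mono hle _).trans ?_
    rw [← Ideal.map_pow, Ideal.map_quotient_self]
  smul_e := thickFrame_smul T x n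

/-! ### The `K`-schemes `Spec A_n → T`, `Spec κ → T` and the infinitesimal neighbourhoods -/

section Geometry

omit [IsLocallyNoetherian T.left]

variable (hB : IsAffineOpen B)

/-- **`Spec A_n → B ⊆ T` is the `n`-th infinitesimal neighbourhood `Spec(𝒪_{T,x}/𝔪^{n+1}) → T`**
of `Motives/TheoremOfCubeThickenings` (`thickeningPtι`; both are
`Spec(𝒪 → 𝒪/𝔪^{n+1}) ≫ (Spec 𝒪_{T,x} → T)`, Mathlib `IsAffineOpen.fromSpecStalk_eq_fromSpecStalk`);
see `modelPt_thickRing` for the resulting equality of `K`-schemes. [folklore] -/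
theorem baseSpec_thickRing (n : ℕ) :
    baseSpec T hB (thickRing T x n) = (thickeningPtι T x.1 n).left := by
  have h1 : (thickeningPtι T x.1 n).left = Spec.map (stalkModPowMk T x.1 n) ≫
      (Spec.map (T.left.presheaf.germ B x.1 x.2) ≫ hB.fromSpec) := by
    rw [thickeningPtι_left_eq, ← hB.fromSpecStalk_eq_fromSpecStalk x.2]
    rfl
  rw [h1, ← Spec.map_comp_assoc]
  rfl

/-- **`Spec κ → B ⊆ T` is the canonical morphism `Spec κ(x) → T`** (Mathlib
`Scheme.fromSpecResidueField`); see `modelPt_resField`. [folklore] -/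
theorem baseSpec_resField :
    baseSpec T hB (resField T x) = T.left.fromSpecResidueField x.1 := by
  have h1 : T.left.fromSpecResidueField x.1 = Spec.map (T.left.residue x.1) ≫
      (Spec.map (T.left.presheaf.germ B x.1 x.2) ≫ hB.fromSpec) := by
    rw [Scheme.fromSpecResidueField, ← hB.fromSpecStalk_eq_fromSpecStalk x.2]
    rfl
  rw [h1, ← Spec.map_comp_assoc]
  rfl

/-- **`modelPt T hB A_n` is the `K`-scheme `thickeningPt T x n`** of
`Motives/TheoremOfCubeThickenings` (equality of objects of `Over (Spec K)`). [folklore] -/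
theorem modelPt_thickRing (n : ℕ) : modelPt T hB (thickRing T x n) = thickeningPt T x.1 n := by
  unfold modelPt ptOver thickeningPt
  rw [baseSpec_thickRing]
  rfl

/-- **`modelPt T hB κ` is the `K`-scheme `residuePt T x`** of `Motives/SeesawTheorem`. [folklore] -/
theorem modelPt_resField : modelPt T hB (resField T x) = residuePt T x.1 := by
  unfold modelPt ptOver residuePt
  rw [baseSpec_resField]
  rfl

/-- `Spec A_n → T` maps everything to `x`. [folklore] -/
theorem baseSpec_thickRing_apply (n : ℕ) (s : Spec (.of (thickRing T x n))) :
    baseSpec T hB (thickRing T x n) s = x.1 := by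
  rw [baseSpec_thickRing]
  exact thickeningPtι_left_apply T x.1 n s

/-- `Spec κ → T` maps everything to `x`. [folklore] -/
theorem baseSpec_resField_apply (s : Spec (.of (resField T x))) :
    baseSpec T hB (resField T x) s = x.1 := by
  rw [baseSpec_resField]
  exact T.left.fromSpecResidueField_apply x.1 s

variable (P : SchemeOver K)

/-- Every point of `P ×_K Spec R` lies over `x` under `P ×_K T → T`, as soon as `Spec R → T` has
image `{x}`. [folklore] -/
theorem snd_whiskerLeft_modelPtι_apply {R : Type u} [CommRing R] [Algebra Γ(T.left, B) R]
    (hR : ∀ s : Spec (.of R), baseSpec T hB R s = x.1) (y : (P ⊗ modelPt T hB R).left) :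
    (snd P T).left ((P ◁ modelPtι T hB R).left y) = x.1 := by
  rw [← Scheme.Hom.comp_apply, whiskerLeft_modelPtι_snd, Scheme.Hom.comp_apply]
  exact hR _

/-! ### Flatness and affineness of the pieces -/

variable {T P}

namespace OpenOver

include hB in
/-- **`Γ(V, 𝒪_{P × T})` is flat over `Γ(B, 𝒪_T)`** for `V ⊆ pr_T⁻¹B` affine: `pr_T` is flat (base
change of `P → Spec K`) and flatness is affine-local (Mathlib `HasRingHomProperty` for `@Flat`).
[folklore] -/
theorem flat_sec (V : OpenOver (snd P T).left B) (hV : IsAffineOpen V.U) :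
    Module.Flat Γ(T.left, B) V.Sec := by
  have hflat : Flat (snd P T).left := inferInstanceAs (Flat (pullback.snd P.hom T.hom))
  exact HasRingHomProperty.appLE (P := @Flat) (snd P T).left hflat ⟨B, hB⟩ ⟨V.U, hV⟩ V.le

/-- **The preimage `ι_R⁻¹V ⊆ P × Spec R` of an affine `V ⊆ pr_T⁻¹B` is affine** (it is
`V ×_B Spec R`; Mathlib `Scheme.Hom.isPullback_resLE`). [folklore] -/
theorem isAffineOpen_thick (R : Type u) [CommRing R] [Algebra Γ(T.left, B) R]
    (V : OpenOver (snd P T).left B) (hV : IsAffineOpen V.U) : IsAffineOpen (V.thick hB R).U := by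
  have H := isPullback_whiskerLeft P (modelPtι T hB R)
  have hUY : (V.thick hB R).U = (P ◁ modelPtι T hB R).left ⁻¹ᵁ V.U ⊓
      (snd P (modelPt T hB R)).left ⁻¹ᵁ ⊤ := (inf_top_eq _).symm
  have : IsAffine B := hB
  have : IsAffine V.U := hV
  have : IsAffine (⊤ : (modelPt T hB R).left.Opens) := isAffineOpen_top _
  exact IsAffine.of_isIso (Scheme.Hom.isPullback_resLE H (top_le_modelPtι_preimage T hB R)
    V.le hUY).isoPullback.hom

include hB in
/-- **Intersections of affine opens over the affine `B` are affine**, `pr_T` being separated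
(`P → Spec K` separated; Mathlib `isAffineHom_diagonal_iff`). [folklore] -/
theorem isAffineOpen_inf [IsSeparated P.hom] (V W : OpenOver (snd P T).left B)
    (hV : IsAffineOpen V.U) (hW : IsAffineOpen W.U) : IsAffineOpen (V.inf W).U := by
  have hsep : IsSeparated (snd P T).left :=
    inferInstanceAs (IsSeparated (pullback.snd P.hom T.hom))
  exact isAffineHom_diagonal_iff.mp
    (inferInstance : IsAffineHom (pullback.diagonal (snd P T).left)) B hB V.U V.le W.U W.le hV hW

end OpenOver

/-! ### A finite affine charted cover of the fibre over `x` -/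

/-- **A finite family of affine opens `V_a ⊆ pr_T⁻¹B ∩ U_{c(a)}` covering the fibre of
`P ×_K T → T` over `x`**, each inside a chart of the Cartier divisor `D` on `P ×_K T`: the
refinement on which the Čech computations of Step (I) of Görtz–Wedhorn II, Lemma 24.72 take place
(all infinitesimal neighbourhoods of the fibre have the same underlying set, so one cover serves
every level). [folklore] -/
structure FibreCover {P T : SchemeOver K} {B : T.left.Opens} (x : B) [IsIntegral (P ⊗ T).left]
    (D : CartierDivisor (P ⊗ T).left) where
  /-- The (finite) index type. -/
  κ : Type u
  /-- Finiteness of the index type. -/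
  [finite : Finite κ]
  /-- The opens, lying over `B`. -/
  V : κ → OpenOver (snd P T).left B
  /-- They are affine. -/
  isAffineOpen : ∀ a, IsAffineOpen (V a).U
  /-- A chart of `D` containing `V_a`. -/
  chart : κ → D.ι
  /-- `V_a ⊆ U_{c(a)}`. -/
  V_le : ∀ a, (V a).U ≤ D.U (chart a)
  /-- The `V_a` cover the fibre over `x`. -/
  covers : ∀ y : (P ⊗ T).left, (snd P T).left y = x.1 → ∃ a, y ∈ (V a).U

namespace FibreCover

variable [IsIntegral (P ⊗ T).left] {D : CartierDivisor (P ⊗ T).left} (𝒱 : FibreCover (P := P) x D)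

/-- The index type of a fibre cover is finite. [folklore] -/
instance finite_κ : Finite 𝒱.κ := 𝒱.finite

/-- The underlying charted family of opens (`Motives/CartierDivisorCechTrivialization`).
[folklore] -/
def toChartedCover : D.ChartedCover := ⟨𝒱.κ, fun a => (𝒱.V a).U, 𝒱.chart, 𝒱.V_le⟩

/-- The opens of the underlying charted family. [folklore] -/
@[simp] theorem toChartedCover_V (a : 𝒱.κ) : 𝒱.toChartedCover.V a = (𝒱.V a).U := rfl

/-- The charts of the underlying charted family. [folklore] -/
@[simp] theorem toChartedCover_chart (a : 𝒱.κ) : 𝒱.toChartedCover.chart a = 𝒱.chart a := rfl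

/-- **The preimages `ι_R⁻¹V_a` cover `P × Spec R`** whenever `Spec R → T` has image `{x}` (every
point of `P × Spec R` lies over `x`). [folklore] -/
theorem iSup_thick {R : Type u} [CommRing R] [Algebra Γ(T.left, B) R]
    (hR : ∀ s : Spec (.of R), baseSpec T hB R s = x.1) :
    (⊤ : (P ⊗ modelPt T hB R).left.Opens) ≤ ⨆ a, (P ◁ modelPtι T hB R).left ⁻¹ᵁ (𝒱.V a).U := by
  intro y _
  obtain ⟨a, ha⟩ := 𝒱.covers ((P ◁ modelPtι T hB R).left y)
    (snd_whiskerLeft_modelPtι_apply T x hB P hR y)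
  exact Opens.mem_iSup.2 ⟨a, ha⟩

end FibreCover

/-- **Existence of a finite affine charted cover of the fibre over `x`** for `P → Spec K`
quasi-compact: the fibre is the image of the compact `P ×_K Spec κ(x)` (Mathlib
`Scheme.Pullback.exists_preimage_pullback`), each of its points has an affine neighbourhood inside
its chart and `pr_T⁻¹B` (affine opens form a basis), and finitely many of these suffice. [folklore] -/
theorem FibreCover.nonempty (hB : IsAffineOpen B) [IsIntegral (P ⊗ T).left] [QuasiCompact P.hom]
    (D : CartierDivisor (P ⊗ T).left) : Nonempty (FibreCover (P := P) x D) := by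
  classical
  -- the fibre is compact: it is the image of `P × Spec κ(x)`
  haveI : QuasiCompact (snd P (modelPt T hB (resField T x))).left :=
    inferInstanceAs (QuasiCompact (pullback.snd P.hom (modelPt T hB (resField T x)).hom))
  haveI : CompactSpace (P ⊗ modelPt T hB (resField T x)).left :=
    QuasiCompact.compactSpace_of_compactSpace (snd P (modelPt T hB (resField T x))).left
  set F : Set (P ⊗ T).left := Set.range (P ◁ modelPtι T hB (resField T x)).left with hFdef
  have hFc : IsCompact F := isCompact_range (P ◁ modelPtι T hB (resField T x)).left.continuous
  have hF : ∀ y : (P ⊗ T).left, (snd P T).left y = x.1 → y ∈ F := by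
    intro y hy
    have hx : x.1 ∈ Set.range (modelPtι T hB (resField T x)).left :=
      ⟨⟨⊥, Ideal.isPrime_bot⟩, baseSpec_resField_apply T x hB _⟩
    obtain ⟨s, hs⟩ := hx
    obtain ⟨z, hz, -⟩ := Scheme.Pullback.exists_preimage_pullback (f := (snd P T).left)
      (g := (modelPtι T hB (resField T x)).left) y s (by rw [hy, hs])
    refine ⟨(isPullback_whiskerLeft P (modelPtι T hB (resField T x))).isoPullback.inv z, ?_⟩
    rw [← Scheme.Hom.comp_apply, IsPullback.isoPullback_inv_fst]
    exact hz
  -- affine neighbourhoods inside the charts and `pr⁻¹B`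
  have hnb : ∀ y ∈ F, ∃ W : (P ⊗ T).left.Opens, IsAffineOpen W ∧ y ∈ W ∧
      W ≤ (snd P T).left ⁻¹ᵁ B ∧ W ≤ D.U (D.covers y).choose := by
    intro y hy
    obtain ⟨s, rfl⟩ := hy
    have hyB : (P ◁ modelPtι T hB (resField T x)).left s ∈ (snd P T).left ⁻¹ᵁ B := by
      change (snd P T).left _ ∈ B
      rw [snd_whiskerLeft_modelPtι_apply T x hB P (baseSpec_resField_apply T x hB)]
      exact x.2
    obtain ⟨W, hW, hyW, hWle⟩ := exists_isAffineOpen_mem_and_subset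
      (show (P ◁ modelPtι T hB (resField T x)).left s ∈ (snd P T).left ⁻¹ᵁ B ⊓
        D.U (D.covers ((P ◁ modelPtι T hB (resField T x)).left s)).choose from
          ⟨hyB, (D.covers _).choose_spec⟩)
    exact ⟨W, hW, hyW, fun z hz => (hWle hz).1, fun z hz => (hWle hz).2⟩
  choose W hWaff hyW hWB hWU using hnb
  -- a finite subcover
  obtain ⟨t, ht⟩ := hFc.elim_finite_subcover (fun y : F => (W y.1 y.2 : Set (P ⊗ T).left))
    (fun y => (W y.1 y.2).isOpen) (fun y hy => Set.mem_iUnion.2 ⟨⟨y, hy⟩, hyW y hy⟩)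
  refine ⟨{ κ := (t : Set F)
            V := fun a => ⟨W a.1.1 a.1.2, hWB a.1.1 a.1.2⟩
            isAffineOpen := fun a => hWaff a.1.1 a.1.2
            chart := fun a => (D.covers a.1.1).choose
            V_le := fun a => hWU a.1.1 a.1.2
            covers := fun y hy => ?_ }⟩
  obtain ⟨a, ha⟩ := Set.mem_iUnion.1 (ht (hF y hy))
  obtain ⟨ha, hya⟩ := Set.mem_iUnion.1 ha
  exact ⟨⟨a, ha⟩, hya⟩

end Geometry

end Literature.AlgebraicGeometry.Motives

end
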